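import Summits.KontsevichZagierPeriods.Zeta5Search.Barrier.ConeGammaTranslateLexKinkBound

/-!
# ζ(5) search — BARRIER: EVERY TIE IS A LITTLE CUSP — the lexicographic germ in REFERENCE-FREE form: the one-sided derivative
# of `σ` (and of `P` on the ball) at `δ` along `Δ` is the greedy functional of the period pattern function LOCALISED at the tied
# classes of `δ`, read in the order of `Δ`; Lemma B on the cluster ball (file (6), sequel of «THE LEXICOGRAPHIC GERM»)

HONEST FRAMING (cell `pub-zeta5`): systematic search; no irrationality claim unless kernel-certified. MODEL objects
under Brown–Zudilin's (28)+(30) accounting ([BZ22] = arXiv:2210.03391; (28) observed, not proved); nothing here is a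
statement about `ζ(5)`, any `γ` of record, the cone's supremum (C2 OPEN) or the value / sign of `σ`, `P`, a chamber weight or a
derivative at a named direction (DATA of the cell); NO cancellation is quantified; S-E / (TD_A) stay CONJECTURED; records in print
UNMOVED. Prover P2 g42 (SEQUEL of the item «THE LEXICOGRAPHIC GERM», file (6); plan INBOX 2026-08-28). Sources: files (1)–(5) of the
item, P2 g33 `ConeGammaCuspPeriodCanonical` (chamber formula), P2 g19/g20 LEMMA B (`cuspSlope_spec`) with P2 g28
`cuspSlope_smul` (homogeneity).

SETTING. `a` with all 28 forms positive, `T > 0` a period, `σ = cuspSlope a T`, `P = translateIntegral a T`, `F` the canonical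
period pattern function, rates `r_k(θ) = φ_k(θ)/h_k(a)`. For a pair `(δ, Δ)` WITHOUT DOUBLE TIE (`r_k(δ) = r_l(δ)` and
`r_k(Δ) = r_l(Δ)` only for `k = l` — `Δ` separates every tied class of `δ`; generic in `Δ`) the lexicographic order is TOTAL and
the chamber weights of any lexicographic reference are EXPLICIT in `(δ, Δ)`:
* `lex_upper_sets_eq` — for any `δ₀` refining the lexicographic order, `{l : ρ₀_k ≤ ρ₀_l} = A≤(k)`, `{l : ρ₀_k < ρ₀_l} = A<(k)`
  with **`A≤(k) = {l : r_k(δ) < r_l(δ) ∨ (r_k(δ) = r_l(δ) ∧ r_k(Δ) ≤ r_l(Δ))}`**, `A<(k)` the strict version: the forms STRICTLY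
  ABOVE the tied class of `k`, plus the part of the class at or above `k` in the order of `Δ`;
* **`cuspSlope_add_smul_eq_lex_explicit` — THE GERM, REFERENCE-FREE**: **`σ(δ + t·Δ) = σ(δ) + t·Σ_k (F(A≤(k)) − F(A<(k)))·r_k(Δ)` on
  `[0, t₀]`** — EVERY TIE IS A LITTLE CUSP: the weight of `k` is the marginal of the LOCALISED pattern function `B ↦ F(U ∪ B)`
  (`U` = the forms strictly above the class of `k`) along the class in the order of `Δ` — the same greedy / Lovász structure by
  which P2 g31–g33 describe `σ` itself at the closed orbit (`δ = 0`: one class, `U = ∅`, and the formula IS g33's chamber formula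
  for `Δ`, i.e. `σ(t·Δ) = t·σ(Δ)`);
* `lex_germ_smul` — the one-sided derivative is positively homogeneous of degree one in `Δ` (the sets are invariant under `Δ ↦ c·Δ`,
  `c > 0`);
* **`translateIntegral_add_smul_eq_lex_explicit`** — the same for `P` at every translate of the open rate ball (file (3));
* **`translateIntegral_sub_zero_eq_cuspSlope_of_shiftSize` — LEMMA B ON THE CLUSTER BALL, hypotheses on `δ` ALONE**: if
  `Y(δ)·(x_max/x_min + 1) < min(1, wallDist a T)` and `2·Y(δ)/x_min < b_{m+1} − b_m` for every consecutive pair of junctions of the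
  period (`Y = shiftSize`), then `P(δ) − P(0) = σ(δ)` — P2 g19/g20's Lemma B (`cuspSlope_spec`, stated at an admissible SCALE of a
  displacement) applied to `δ/ρ` at a small scale `ρ` and read back through homogeneity (`cuspSlope_smul`): the cluster-side
  companion of file (3)'s rate ball (two sufficient regions, neither containing the other in general).
NOT here (honest): pairs with a double tie (there the two sets depend on the reference; file (1)'s `lex_functional_eq` still fixes
the VALUE of the germ); any value at a named direction (DATA); beyond the balls ((TD_A) CONJECTURED); `Φ`, `γ`, C2, S-E's truth,
`ζ(5)`.
-/

noncomputable section

open Set Finset Filter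
open scoped Topology

namespace Summit.KontsevichZagierPeriods.Zeta5Search.Barrier.ConeGamma

/-! ### The lexicographic upper sets, explicitly -/

/-- **The upper sets of a lexicographic reference are explicit** when `(δ, Δ)` has no double tie: for any `δ₀` refining the
lexicographic order of `(δ, Δ)` and every `k`,
`{l : ρ₀_k ≤ ρ₀_l} = {l : r_k(δ) < r_l(δ) ∨ (r_k(δ) = r_l(δ) ∧ r_k(Δ) ≤ r_l(Δ))}` and
`{l : ρ₀_k < ρ₀_l} = {l : r_k(δ) < r_l(δ) ∨ (r_k(δ) = r_l(δ) ∧ r_k(Δ) < r_l(Δ))}`. -/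
theorem lex_upper_sets_eq {a : Dir} {δ Δ δ₀ : Fin 8 → ℝ}
    (hsep : ∀ k l : Fin 28, k ≠ l → phiForm δ k / h28 a k = phiForm δ l / h28 a l →
      phiForm Δ k / h28 a k ≠ phiForm Δ l / h28 a l)
    (hlex : ∀ k l : Fin 28, (phiForm δ k / h28 a k < phiForm δ l / h28 a l ∨
        (phiForm δ k / h28 a k = phiForm δ l / h28 a l ∧ phiForm Δ k / h28 a k < phiForm Δ l / h28 a l)) →
      phiForm δ₀ k / h28 a k < phiForm δ₀ l / h28 a l) (k : Fin 28) :
    (Finset.univ.filter fun l => phiForm δ₀ k / h28 a k ≤ phiForm δ₀ l / h28 a l) =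
        Finset.univ.filter (fun l => phiForm δ k / h28 a k < phiForm δ l / h28 a l ∨
          (phiForm δ k / h28 a k = phiForm δ l / h28 a l ∧ phiForm Δ k / h28 a k ≤ phiForm Δ l / h28 a l)) ∧
      (Finset.univ.filter fun l => phiForm δ₀ k / h28 a k < phiForm δ₀ l / h28 a l) =
        Finset.univ.filter (fun l => phiForm δ k / h28 a k < phiForm δ l / h28 a l ∨
          (phiForm δ k / h28 a k = phiForm δ l / h28 a l ∧ phiForm Δ k / h28 a k < phiForm Δ l / h28 a l)) := by
  -- trichotomy in the lexicographic order, for `l ≠ k`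
  have key : ∀ l, l ≠ k →
      ((phiForm δ₀ k / h28 a k < phiForm δ₀ l / h28 a l) ∧
        (phiForm δ k / h28 a k < phiForm δ l / h28 a l ∨
          (phiForm δ k / h28 a k = phiForm δ l / h28 a l ∧ phiForm Δ k / h28 a k < phiForm Δ l / h28 a l))) ∨
      ((phiForm δ₀ l / h28 a l < phiForm δ₀ k / h28 a k) ∧
        ¬(phiForm δ k / h28 a k < phiForm δ l / h28 a l ∨
          (phiForm δ k / h28 a k = phiForm δ l / h28 a l ∧ phiForm Δ k / h28 a k ≤ phiForm Δ l / h28 a l))) := by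
    intro l hlk
    rcases lt_trichotomy (phiForm δ k / h28 a k) (phiForm δ l / h28 a l) with h | h | h
    · exact Or.inl ⟨hlex k l (Or.inl h), Or.inl h⟩
    · rcases (hsep k l (Ne.symm hlk) h).lt_or_gt with h' | h'
      · exact Or.inl ⟨hlex k l (Or.inr ⟨h, h'⟩), Or.inr ⟨h, h'⟩⟩
      · refine Or.inr ⟨hlex l k (Or.inr ⟨h.symm, h'⟩), ?_⟩
        rintro (h1 | ⟨-, h1⟩)
        · exact absurd (h.symm ▸ h1) (lt_irrefl _)
        · exact absurd (h1.trans_lt h') (lt_irrefl _)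
    · refine Or.inr ⟨hlex l k (Or.inl h), ?_⟩
      rintro (h1 | ⟨h1, -⟩)
      · exact absurd (h.trans h1) (lt_irrefl _)
      · exact absurd (h1 ▸ h) (lt_irrefl _)
  constructor
  · ext l
    simp only [Finset.mem_filter, Finset.mem_univ, true_and]
    by_cases hlk : l = k
    · subst hlk
      exact ⟨fun _ => Or.inr ⟨rfl, le_rfl⟩, fun _ => le_rfl⟩
    rcases key l hlk with ⟨h0, h1⟩ | ⟨h0, h1⟩
    · exact ⟨fun _ => h1.imp_right fun h => ⟨h.1, h.2.le⟩, fun _ => h0.le⟩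
    · exact ⟨fun h => absurd (h0.trans_le h) (lt_irrefl _), fun h => absurd h h1⟩
  · ext l
    simp only [Finset.mem_filter, Finset.mem_univ, true_and]
    by_cases hlk : l = k
    · subst hlk
      exact ⟨fun h => absurd h (lt_irrefl _), fun h => by
        rcases h with h | ⟨-, h⟩ <;> exact absurd h (lt_irrefl _)⟩
    rcases key l hlk with ⟨h0, h1⟩ | ⟨h0, h1⟩
    · exact ⟨fun _ => h1, fun _ => h0⟩
    · refine ⟨fun h => absurd (h0.trans h) (lt_irrefl _), fun h => absurd ?_ h1⟩
      exact h.imp_right fun h' => ⟨h'.1, h'.2.le⟩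

/-! ### THE GERM, reference-free: every tie is a little cusp -/

/-- **THE LEXICOGRAPHIC GERM OF `σ`, REFERENCE-FREE — EVERY TIE IS A LITTLE CUSP.** All 28 forms of `a` positive, `T > 0` a
period, `F` the canonical period pattern function; `(δ, Δ)` without double tie. Then there is `t₀ > 0` with
**`σ(δ + t·Δ) = σ(δ) + t·Σ_k (F(A≤(k)) − F(A<(k)))·φ_k(Δ)/h_k(a)` for all `t ∈ [0, t₀]`**,
`A≤(k) = {l : r_k(δ) < r_l(δ) ∨ (r_k(δ) = r_l(δ) ∧ r_k(Δ) ≤ r_l(Δ))}`, `A<(k)` its strict version: the weight of `k` is the marginal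
of `F` localised above the tied class of `k`, along the class in the order of `Δ` (at `δ = 0`: g33's chamber formula for `Δ`). -/
theorem cuspSlope_add_smul_eq_lex_explicit {a : Dir} (hpos : ∀ k, 0 < h28 a k) {T : ℝ} (hT : 0 < T)
    (hper : ∀ k : Fin 28, ∃ z : ℤ, T * h28 a k = z) {F : Finset (Fin 28) → ℝ}
    (hF : ∀ A, F A = ∑ m ∈ Finset.range ((bkpts a T).card - 1), ((patternN a (bkpt a T m) A : ℤ) : ℝ))
    (δ Δ : Fin 8 → ℝ)
    (hsep : ∀ k l : Fin 28, k ≠ l → phiForm δ k / h28 a k = phiForm δ l / h28 a l →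
      phiForm Δ k / h28 a k ≠ phiForm Δ l / h28 a l) :
    ∃ t₀ : ℝ, 0 < t₀ ∧ ∀ t ∈ Icc (0 : ℝ) t₀,
      cuspSlope a T (δ + t • Δ) = cuspSlope a T δ +
        t * ∑ k, (F (Finset.univ.filter fun l => phiForm δ k / h28 a k < phiForm δ l / h28 a l ∨
              (phiForm δ k / h28 a k = phiForm δ l / h28 a l ∧ phiForm Δ k / h28 a k ≤ phiForm Δ l / h28 a l)) -
            F (Finset.univ.filter fun l => phiForm δ k / h28 a k < phiForm δ l / h28 a l ∨
              (phiForm δ k / h28 a k = phiForm δ l / h28 a l ∧ phiForm Δ k / h28 a k < phiForm Δ l / h28 a l))) *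
          (phiForm Δ k / h28 a k) := by
  obtain ⟨δ₀, hgen, hlex⟩ := exists_generic_refines_lex hpos δ Δ
  obtain ⟨t₀, ht₀, h⟩ := cuspSlope_add_smul_eq_of_lex hpos hT hper hF δ Δ hgen hlex
  refine ⟨t₀, ht₀, fun t ht => ?_⟩
  rw [h t ht]
  congr 1; congr 1
  refine Finset.sum_congr rfl fun k _ => ?_
  obtain ⟨h1, h2⟩ := lex_upper_sets_eq hsep hlex k
  rw [h1, h2]

/-- **The germ is positively homogeneous of degree one in the direction**: for `c > 0` the localised greedy functional of `c·Δ`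
is `c` times that of `Δ` (the sets `A≤`, `A<` are invariant). -/
theorem lex_germ_smul {a : Dir} (F : Finset (Fin 28) → ℝ) (δ Δ : Fin 8 → ℝ) {c : ℝ} (hc : 0 < c) :
    ∑ k, (F (Finset.univ.filter fun l => phiForm δ k / h28 a k < phiForm δ l / h28 a l ∨
          (phiForm δ k / h28 a k = phiForm δ l / h28 a l ∧
            phiForm (c • Δ) k / h28 a k ≤ phiForm (c • Δ) l / h28 a l)) -
        F (Finset.univ.filter fun l => phiForm δ k / h28 a k < phiForm δ l / h28 a l ∨
          (phiForm δ k / h28 a k = phiForm δ l / h28 a l ∧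
            phiForm (c • Δ) k / h28 a k < phiForm (c • Δ) l / h28 a l))) * (phiForm (c • Δ) k / h28 a k) =
      c * ∑ k, (F (Finset.univ.filter fun l => phiForm δ k / h28 a k < phiForm δ l / h28 a l ∨
          (phiForm δ k / h28 a k = phiForm δ l / h28 a l ∧ phiForm Δ k / h28 a k ≤ phiForm Δ l / h28 a l)) -
        F (Finset.univ.filter fun l => phiForm δ k / h28 a k < phiForm δ l / h28 a l ∨
          (phiForm δ k / h28 a k = phiForm δ l / h28 a l ∧ phiForm Δ k / h28 a k < phiForm Δ l / h28 a l))) *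
        (phiForm Δ k / h28 a k) := by
  have hr : ∀ k, phiForm (c • Δ) k / h28 a k = c * (phiForm Δ k / h28 a k) := fun k => by rw [phiForm_smul]; ring
  have hle : ∀ k l, (phiForm (c • Δ) k / h28 a k ≤ phiForm (c • Δ) l / h28 a l ↔
      phiForm Δ k / h28 a k ≤ phiForm Δ l / h28 a l) := fun k l => by
    rw [hr, hr]
    exact ⟨fun h => le_of_mul_le_mul_left h hc, fun h => mul_le_mul_of_nonneg_left h hc.le⟩
  have hlt : ∀ k l, (phiForm (c • Δ) k / h28 a k < phiForm (c • Δ) l / h28 a l ↔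
      phiForm Δ k / h28 a k < phiForm Δ l / h28 a l) := fun k l => by
    rw [hr, hr]
    exact ⟨fun h => lt_of_mul_lt_mul_left h hc.le, fun h => mul_lt_mul_of_pos_left h hc⟩
  simp only [hle, hlt]
  simp only [hr, Finset.mul_sum]
  exact Finset.sum_congr rfl fun k _ => by ring

/-- **THE LEXICOGRAPHIC GERM OF `P`, REFERENCE-FREE**: at every translate `δ` of the OPEN rate ball (`|r_k(δ)| < ρ̄`,
`2ρ̄·T·x_max² < 1`, `2ρ̄·x_max < 1`, `2ρ̄·x_max < wallDist a T`) and every direction `Δ` without double tie with `δ`: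
`P(δ + t·Δ) = P(δ) + t·Σ_k (F(A≤(k)) − F(A<(k)))·φ_k(Δ)/h_k(a)` on `[0, t₀]`. -/
theorem translateIntegral_add_smul_eq_lex_explicit {a : Dir} (hpos : ∀ k, 0 < h28 a k) {T : ℝ} (hT : 0 < T)
    (hper : ∀ k : Fin 28, ∃ z : ℤ, T * h28 a k = z) {F : Finset (Fin 28) → ℝ}
    (hF : ∀ A, F A = ∑ m ∈ Finset.range ((bkpts a T).card - 1), ((patternN a (bkpt a T m) A : ℤ) : ℝ))
    {δ : Fin 8 → ℝ} {ρb : ℝ} (hρ : ∀ k, |phiForm δ k / h28 a k| < ρb) (hρT : 2 * ρb * T * xMax a ^ 2 < 1)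
    (hc1 : 2 * ρb * xMax a < 1) (hc2 : 2 * ρb * xMax a < wallDist a T) (Δ : Fin 8 → ℝ)
    (hsep : ∀ k l : Fin 28, k ≠ l → phiForm δ k / h28 a k = phiForm δ l / h28 a l →
      phiForm Δ k / h28 a k ≠ phiForm Δ l / h28 a l) :
    ∃ t₀ : ℝ, 0 < t₀ ∧ ∀ t ∈ Icc (0 : ℝ) t₀,
      translateIntegral a T (δ + t • Δ) = translateIntegral a T δ +
        t * ∑ k, (F (Finset.univ.filter fun l => phiForm δ k / h28 a k < phiForm δ l / h28 a l ∨
              (phiForm δ k / h28 a k = phiForm δ l / h28 a l ∧ phiForm Δ k / h28 a k ≤ phiForm Δ l / h28 a l)) -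
            F (Finset.univ.filter fun l => phiForm δ k / h28 a k < phiForm δ l / h28 a l ∨
              (phiForm δ k / h28 a k = phiForm δ l / h28 a l ∧ phiForm Δ k / h28 a k < phiForm Δ l / h28 a l))) *
          (phiForm Δ k / h28 a k) := by
  obtain ⟨δ₀, hgen, hlex⟩ := exists_generic_refines_lex hpos δ Δ
  obtain ⟨t₀, ht₀, h⟩ := translateIntegral_add_smul_eq_of_lex hpos hT hper hF hρ hρT hc1 hc2 Δ hgen hlex
  refine ⟨t₀, ht₀, fun t ht => ?_⟩
  rw [h t ht]
  congr 1; congr 1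
  refine Finset.sum_congr rfl fun k _ => ?_
  obtain ⟨h1, h2⟩ := lex_upper_sets_eq hsep hlex k
  rw [h1, h2]

/-! ### LEMMA B on the cluster ball -/

/-- **LEMMA B ON THE CLUSTER BALL — hypotheses on `δ` alone.** All 28 forms of `a` positive, `T > 0` a period; if
`Y(δ)·(x_max/x_min + 1) < 1`, `Y(δ)·(x_max/x_min + 1) < wallDist a T` (`Y = shiftSize`) and `2·Y(δ)/x_min < b_{m+1} − b_m` for every
consecutive pair of junctions of the period, then **`P(δ) − P(0) = cuspSlope a T δ`** (Lemma B for `δ/ρ` at the scale `ρ`, with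
`ρ·clusterBound(δ/ρ) = Y·(x_max/x_min + 1) + ρ·x_max` and `2ρ·clusterWidth(δ/ρ) = 2Y/x_min + 2ρ`, for `ρ` below the slacks; then
`ρ·σ(δ/ρ) = σ(δ)`). -/
theorem translateIntegral_sub_zero_eq_cuspSlope_of_shiftSize {a : Dir} (hpos : ∀ k, 0 < h28 a k) {T : ℝ} (hT : 0 < T)
    (hper : ∀ k : Fin 28, ∃ z : ℤ, T * h28 a k = z) {δ : Fin 8 → ℝ}
    (h1 : shiftSize δ * (xMax a / xMin a + 1) < 1) (h2 : shiftSize δ * (xMax a / xMin a + 1) < wallDist a T)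
    (hgap : ∀ m, m + 1 < (bkpts a T).card → 2 * shiftSize δ / xMin a < bkpt a T (m + 1) - bkpt a T m) :
    translateIntegral a T δ - translateIntegral a T 0 = cuspSlope a T δ := by
  have hxm := xMin_pos hpos
  have hxM := xMax_pos hpos
  have hY := shiftSize_nonneg δ
  have hc := two_le_card_bkpts a hT
  have hne : (Finset.range ((bkpts a T).card - 1)).Nonempty := ⟨0, Finset.mem_range.mpr (by omega)⟩
  -- the smallest gap slack
  obtain ⟨g, hgpos, hgle⟩ : ∃ g : ℝ, 0 < g ∧ ∀ m, m + 1 < (bkpts a T).card →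
      g ≤ bkpt a T (m + 1) - bkpt a T m - 2 * shiftSize δ / xMin a := by
    refine ⟨(Finset.range ((bkpts a T).card - 1)).inf' hne fun m =>
        bkpt a T (m + 1) - bkpt a T m - 2 * shiftSize δ / xMin a, ?_,
      fun m hm => Finset.inf'_le _ (Finset.mem_range.mpr (by omega))⟩
    rw [Finset.lt_inf'_iff]
    intro m hm
    rw [Finset.mem_range] at hm
    exact sub_pos.mpr (hgap m (by omega))
  -- the scale `ρ`
  obtain ⟨ρ, hρ⟩ : ∃ ρ : ℝ, ρ = min (min ((1 - shiftSize δ * (xMax a / xMin a + 1)) / (2 * xMax a))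
      ((wallDist a T - shiftSize δ * (xMax a / xMin a + 1)) / (2 * xMax a))) (g / 4) := ⟨_, rfl⟩
  have hρpos : 0 < ρ := by
    rw [hρ]
    exact lt_min (lt_min (div_pos (by linarith) (by linarith)) (div_pos (by linarith) (by linarith))) (by linarith)
  have hρ1 : ρ ≤ (1 - shiftSize δ * (xMax a / xMin a + 1)) / (2 * xMax a) := by
    rw [hρ]; exact (min_le_left _ _).trans (min_le_left _ _)
  have hρ2 : ρ ≤ (wallDist a T - shiftSize δ * (xMax a / xMin a + 1)) / (2 * xMax a) := by
    rw [hρ]; exact (min_le_left _ _).trans (min_le_right _ _)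
  have hρ3 : ρ ≤ g / 4 := by rw [hρ]; exact min_le_right _ _
  -- the cluster data of `δ/ρ` at the scale `ρ`
  have hYρ : shiftSize (ρ⁻¹ • δ) = ρ⁻¹ * shiftSize δ := by rw [shiftSize_smul, abs_of_pos (inv_pos.mpr hρpos)]
  have hK : ρ * clusterBound a (ρ⁻¹ • δ) = shiftSize δ * (xMax a / xMin a + 1) + ρ * xMax a := by
    unfold clusterBound clusterWidth
    rw [hYρ]
    field_simp
    ring
  have hW : 2 * ρ * clusterWidth a (ρ⁻¹ • δ) = 2 * shiftSize δ / xMin a + 2 * ρ := by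
    unfold clusterWidth
    rw [hYρ]
    field_simp
  have hB1 : ρ * clusterBound a (ρ⁻¹ • δ) < 1 := by
    rw [hK]
    have : ρ * (2 * xMax a) ≤ 1 - shiftSize δ * (xMax a / xMin a + 1) := by
      rwa [le_div_iff₀ (by linarith)] at hρ1
    nlinarith
  have hB2 : ρ * clusterBound a (ρ⁻¹ • δ) < wallDist a T := by
    rw [hK]
    have : ρ * (2 * xMax a) ≤ wallDist a T - shiftSize δ * (xMax a / xMin a + 1) := by
      rwa [le_div_iff₀ (by linarith)] at hρ2
    nlinarith
  have hB3 : ∀ m, m + 1 < (bkpts a T).card →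
      2 * ρ * clusterWidth a (ρ⁻¹ • δ) ≤ bkpt a T (m + 1) - bkpt a T m := fun m hm => by
    rw [hW]
    have := hgle m hm
    linarith
  -- Lemma B at the scale `ρ` for `δ/ρ`, and homogeneity
  have hLB := cuspSlope_spec hpos hT hper (ρ⁻¹ • δ) hρpos hB1 hB2 hB3
  rw [smul_smul, mul_inv_cancel₀ hρpos.ne', one_smul] at hLB
  rw [hLB, ← cuspSlope_smul hpos hT hper (ρ⁻¹ • δ) hρpos, smul_smul, mul_inv_cancel₀ hρpos.ne', one_smul]

end Summit.KontsevichZagierPeriods.Zeta5Search.Barrier.ConeGamma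

end
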